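import Literature.Probability.Percolation.IsoradialRectangularCrossingsOfSS
import Literature.Probability.Percolation.IsoradialRectangularCrossingsSS
import Literature.Probability.Percolation.QuadCrossingRotationInvarianceOfThm21
import HarnessLib

/-!
# DKKMO Theorem 2.1 (`q = 1`): the per-quad fact and Cor. 1.3 from the named `d_SS` fact, by name

Topic `Probability/Percolation`; proofs only (no definition, no named fact). Short sequel of
`IsoradialRectangularCrossingsOfSS.lean` (the per-quad reading `DKKMO2020_thm21_quadCrossingProb` of
Duminil-Copin–Kozlowski–Krachun–Manolescu–Oulamara, arXiv:2012.11672v1, Theorem 2.1 at `q = 1`, from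
the Schramm–Smirnov half of that theorem given as an explicit hypothesis `hSS`) and
`IsoradialRectangularCrossingsSS.lean` (that half as the named fact `DKKMO2020_thm21_schrammSmirnov`,
whose body is `hSS` with `isoRectQuadConfig α δ ω = configOf (isoRectDrawing α) δ univ (ω ∩ E)`):

* `DKKMO2020_thm21_quadCrossingProb_of_thm21_schrammSmirnov` — **the named per-quad fact is a
  COROLLARY of the named printed coupling fact** (Schramm–Smirnov's Lemma 5.1 being discharged in
  the tree), so that every consumer of `DKKMO2020_thm21_quadCrossingProb` — DKKMO Cor. 1.3
  `dkkmo_crossing_rotation_invariance` (`QuadCrossingRotationInvarianceOfThm21.lean`) and the known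
  half of the crux `BoxFamilyToCardy` of `CardyFormulaZ2` — rests on the printed Theorem 2.1 alone;
* `dkkmo_crossing_rotation_invariance_of_thm21_schrammSmirnov` — Cor. 1.3 (`q = 1`) from the same
  named fact (via `dkkmo_crossing_rotation_invariance_of_thm21_of_lemma_5_1`).

## References

* [DKKMO2020Rotational] arXiv:2012.11672v1, Thm. 2.1 p. 7, Cor. 1.3 p. 5, §7.1 p. 43.
* [SchrammSmirnov2011] O. Schramm, S. Smirnov, Ann. Probab. 39 (2011), Lemma 5.1.
-/

noncomputable section

namespace Literature.Probability.Percolation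

/-- **`DKKMO2020_thm21_quadCrossingProb` from the named fact `DKKMO2020_thm21_schrammSmirnov`**
(DKKMO Thm. 2.1, `d_SS` half, `q = 1`) — `DKKMO2020_thm21_quadCrossingProb_of_schrammSmirnov'`
with the hypothesis supplied by name (`isoRectQuadConfig` unfolds to the `configOf` of the drawn
lattice definitionally). [cite: DKKMO2020Rotational, Thm. 2.1 (q = 1), with §7.1 p. 43] -/
theorem DKKMO2020_thm21_quadCrossingProb_of_thm21_schrammSmirnov
    (h : DKKMO2020_thm21_schrammSmirnov) : DKKMO2020_thm21_quadCrossingProb :=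
  DKKMO2020_thm21_quadCrossingProb_of_schrammSmirnov' fun ε hε N hN hdiag => h ε hε N hN hdiag

/-- **DKKMO Cor. 1.3 at `q = 1` (`dkkmo_crossing_rotation_invariance`) from the named fact
`DKKMO2020_thm21_schrammSmirnov`**: Cor. 1.3 follows in the tree from the per-quad Theorem 2.1 and
Schramm–Smirnov's Lemma 5.1 (`dkkmo_crossing_rotation_invariance_of_thm21_of_lemma_5_1`,
`SchrammSmirnov2011_lemma_5_1_holds`). [cite: DKKMO2020Rotational, Cor. 1.3 (q = 1)] -/
theorem dkkmo_crossing_rotation_invariance_of_thm21_schrammSmirnov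
    (h : DKKMO2020_thm21_schrammSmirnov) : dkkmo_crossing_rotation_invariance :=
  dkkmo_crossing_rotation_invariance_of_thm21_of_lemma_5_1
    (DKKMO2020_thm21_quadCrossingProb_of_thm21_schrammSmirnov h)
    QuadCrossing.SchrammSmirnov2011_lemma_5_1_holds

end Literature.Probability.Percolation

end
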